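import Literature.AlgebraicGeometry.Frobenioids.PadicFrobenioidFieldUnitsReconstruction
import Mathlib.CategoryTheory.Limits.HasLimits
import HarnessLib

/-!
# Frobenioids II, Thm. 2.4 (ii), first step (β)/(γ): `B ≅ B₀|_D` as FUNCTORS for a fieldwise saturated
# `p`-adic Frobenioid, and the induced isomorphisms of direct limits ("`K̄ᵢ^×` by varying `Aᵢ`"; transport along `Ψ`)

Mochizuki, *The geometry of Frobenioids II*, Kyushu J. Math. **62** (2008) 401–460, §2, proof of Theorem
2.4 (ii), p. 20 l.−3 – p. 21 l.6 [cite: MochizukiFrdII2008, Thm 2.4 (ii) p.20], VERBATIM (author's PDF,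
`paper:url-4322d76898e0` p. 20 last 3 lines – p. 21 l. 6, read 2026-08-26): "Then since `Φᵢ` is fieldwise
saturated, it follows — by varying the objects `Aᵢ` [that correspond via `Ψ`] and reconstructing the
multiplicative group associated to the field determined by the image of `Aᵢ` in `B(Gᵢ, Gᵢ°)` as the
groupification of the monoid `O^▷(Aᵢ) = O^□(Aᵢ)` — that `Ψ` induces a pair of compatible isomorphisms
`G₁ ⥲ G₂`; `K̄₁^× ⥲ K̄₂^×` — where this pair is well-defined up to composition with automorphisms of the pair
`(G₂, K̄₂^×)` induced by elements of `G₂`."  And p. 20 (proof of (i)): "`Ψ` induces a 1-compatible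
equivalence of categories `Ψ^Base : D₁ ⥲ D₂`, as well as compatible isomorphisms of functors `Φ₁ ⥲ Φ₂`,
`B₁ ⥲ B₂` — where we regard “`O^▷(−)`” as a subfunctor of `Bᵢ` [such that `Bᵢ` is the groupification of
“`O^▷(−)`”] which is preserved by the isomorphism `B₁ ⥲ B₂`".

PROOF-ONLY file (abc-iut cell, layer L1, `plan/L1/SUBDAG-FrdII-Thm24.md` row **W12-L17 `PairIso`**, pieces
(β)/(γ) of the census of seat abc-iut-w5-d188; abc-iut-L1-lead R97 (5)(a): "(β)(γ) as THEOREMS with the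
filteredness / L02 slots displayed as hypotheses, no new `Prop` definitions"), over (α1)
(`PadicFrobenioidFieldUnitsReconstruction.lean`: `B(A) ⥲ K_A^×` objectwise):

* (β) `isIso_toB0_of_isFieldwiseSaturated` — for a FIELDWISE SATURATED datum the first projection
  `B → B₀|_D` is an ISOMORPHISM OF FUNCTORS `Dᵒᵖ ⥤ CommMonCat` (objectwise bijective ⇒ objectwise iso, the
  forgetful functor of `CommMonCat` reflecting isomorphisms ⇒ natural iso); hence, for ANY system
  `c : J ⥤ Dᵒᵖ` of objects admitting the two colimits, `lim→_j B(A_j) ≅ lim→_j K_{A_j}^×`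
  (`nonempty_colimit_iso_of_isFieldwiseSaturated`).  DESIGN NOTE ("by varying `Aᵢ`"): `Dᵒᵖ` itself is not
  filtered for a Galois-type base (parallel deck transformations are never coequalised), so the "direct
  limit over the objects" of print is the colimit along a chosen COFINAL DIRECTED system `c` (a universal
  covering / basepoint) — which is exactly why the printed pair is "well-defined up to composition with an
  inner automorphism"; `c` is therefore a PARAMETER here, and the identification of `lim→_j K_{A_j}^×` with
  the multiplicative group of an algebraic closure is origin-level content (the temperoid structure of
  `D = B^temp(Π, Π°)⁰`, abc-iut-L1-t4's QuasiTemperoid files), not asserted.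
* (γ) `nonempty_colimit_iso_of_equivalence` — TRANSPORT ALONG `Ψ`: given the 1-compatible base equivalence
  `E : D₁ ≌ D₂` and the natural isomorphism `ΨB : B₁ ≅ E^op ⋙ B₂` that an equivalence of Frobenioids
  `Ψ : C₁ ⥲ C₂` induces ([FrdII] Thm. 1.2 (i) / [FrdI] Thm. 3.4 (v), Cor. 4.10, 4.11 (ii)(iii) — sub-DAG row
  L02, DISPLAYED AS HYPOTHESES), the direct limits of `B₁` along `c` and of `B₂` along `E ∘ c` are isomorphic;
  with (β) on both sides, `lim→ K_{1,A_j}^× ≅ lim→ K_{2,Ψ A_j}^×` (`nonempty_fieldUnits_colimit_iso_of_equivalence`)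
  — the `K̄₁^× ⥲ K̄₂^×` of print along corresponding cofinal systems.  The compatibility with `G₁ ⥲ G₂`
  (the Galois actions on the two colimits) needs the temperoid structure of the bases and is NOT typed here.
Theorems only; nothing here bears on [IUTchIII] Cor. 3.12.
-/

namespace Literature.AlgebraicGeometry.Frobenioids

open CategoryTheory CategoryTheory.Limits Opposite Function

universe w w' v v₂ u

namespace PadicFrd.Datum

variable {D : Type u} [Category.{v} D] {p : ℕ} [Fact p.Prime] (d : Datum D p)

/-! ### (β) `B ≅ B₀|_D` as functors -/

/-- For a fieldwise saturated datum every component `B(A) → K_A^×` of `B → B₀|_D` is an isomorphism of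
`CommMonCat` (bijective, (α1)). [cite: MochizukiFrdII2008, Thm 2.4 (ii) p.20] -/
theorem isIso_toB0_app_of_isFieldwiseSaturated (hfs : d.IsFieldwiseSaturated) (A : Dᵒᵖ) :
    IsIso (d.toB0.app A) :=
  (MulEquiv.ofBijective (d.toB0.app A).hom
    (d.toB0_bijective_of_isFieldwiseSaturated hfs A)).toCommMonCatIso.isIso_hom

/-- **`B ⥲ B₀|_D` is a natural ISOMORPHISM for a fieldwise saturated `p`-adic Frobenioid** — the functor
`A ↦ B(A_D) (= O^▷(A)^gp)` IS the functor `A ↦ K_A^×` (print: "reconstructing the multiplicative group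
associated to the field determined by the image of `Aᵢ` … as the groupification of the monoid `O^▷(Aᵢ)`",
p. 20 l.−2 – p. 21 l. 2; here uniformly in `A`). [cite: MochizukiFrdII2008, Thm 2.4 (ii) p.20] -/
theorem isIso_toB0_of_isFieldwiseSaturated (hfs : d.IsFieldwiseSaturated) : IsIso d.toB0 :=
  haveI := d.isIso_toB0_app_of_isFieldwiseSaturated hfs
  NatIso.isIso_of_isIso_app d.toB0

/-- **(β) "by varying the objects `Aᵢ`" (p. 20 l.−2): the direct limits agree** — for ANY system of objects `c : J ⥤ Dᵒᵖ` along which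
both colimits exist, `lim→_j B(A_j) ≅ lim→_j K_{A_j}^×`, induced by `B ⥲ B₀|_D` (the intended `c` is a cofinal
directed system of connected coverings, i.e. a universal covering; see the module docstring).
[cite: MochizukiFrdII2008, Thm 2.4 (ii) p.20] -/
theorem nonempty_colimit_iso_of_isFieldwiseSaturated (hfs : d.IsFieldwiseSaturated)
    {J : Type w} [Category.{w'} J] (c : J ⥤ Dᵒᵖ)
    [HasColimit (c ⋙ d.B)] [HasColimit (c ⋙ bZeroOn d.base)] :
    Nonempty (colimit (c ⋙ d.B) ≅ colimit (c ⋙ bZeroOn d.base)) :=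
  haveI := d.isIso_toB0_of_isFieldwiseSaturated hfs
  ⟨HasColimit.isoOfNatIso (Functor.isoWhiskerLeft c (asIso d.toB0))⟩

end PadicFrd.Datum

/-! ### (γ) Transport along an equivalence of Frobenioids -/

namespace PadicFrd

variable {D₁ : Type u} [Category.{v} D₁] {D₂ : Type u} [Category.{v₂} D₂] {p₁ p₂ : ℕ}
  [Fact p₁.Prime] [Fact p₂.Prime] (d₁ : Datum D₁ p₁) (d₂ : Datum D₂ p₂)

/-- **(γ) Transport of the direct limit of `B` along `Ψ`.**  HYPOTHESES (sub-DAG row L02, [FrdII] Thm. 1.2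
(i) + [FrdI] Thm. 3.4 (v), Cor. 4.10, 4.11 (ii)(iii)): the base equivalence `E : D₁ ≌ D₂` induced by `Ψ` and
the natural isomorphism `ΨB : B₁ ≅ E^op ⋙ B₂` ("`Ψ` preserves `O^⊳(−)`", hence `B`).  CONCLUSION: along any
system `c : J ⥤ D₁ᵒᵖ` and its image `c ⋙ E^op`, the direct limits of `B₁` and `B₂` are isomorphic.
[cite: MochizukiFrdII2008, Thm 2.4 (ii) p.20] -/
theorem nonempty_colimit_iso_of_equivalence (E : D₁ ≌ D₂) (ΨB : d₁.B ≅ E.functor.op ⋙ d₂.B)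
    {J : Type w} [Category.{w'} J] (c : J ⥤ D₁ᵒᵖ)
    [HasColimit (c ⋙ d₁.B)] [HasColimit ((c ⋙ E.functor.op) ⋙ d₂.B)] :
    Nonempty (colimit (c ⋙ d₁.B) ≅ colimit ((c ⋙ E.functor.op) ⋙ d₂.B)) :=
  ⟨HasColimit.isoOfNatIso ((Functor.isoWhiskerLeft c ΨB).trans (Functor.associator c E.functor.op d₂.B).symm)⟩

/-- **(γ) with (β): `lim→ K_{1,A_j}^× ≅ lim→ K_{2,Ψ A_j}^×`** for FIELDWISE SATURATED `Φ₁`, `Φ₂` — the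
isomorphism "`K̄₁^× ⥲ K̄₂^×`" that "`Ψ` induces" (FrdII p. 21 ll. 2–4) along corresponding cofinal systems, from the L02
slots `E`, `ΨB` (hypotheses) and (β) on both sides.  (The compatibility with the induced `G₁ ⥲ G₂` — the
"pair of compatible isomorphisms … well-defined up to composition with automorphisms of the pair `(G₂, K̄₂^×)`
induced by elements of `G₂`", p. 21 ll. 2–6 — needs the temperoid structure of the bases and is not typed
here.) [cite: MochizukiFrdII2008, Thm 2.4 (ii) p.21] -/
theorem nonempty_fieldUnits_colimit_iso_of_equivalence (hfs₁ : d₁.IsFieldwiseSaturated)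
    (hfs₂ : d₂.IsFieldwiseSaturated) (E : D₁ ≌ D₂) (ΨB : d₁.B ≅ E.functor.op ⋙ d₂.B)
    {J : Type w} [Category.{w'} J] (c : J ⥤ D₁ᵒᵖ)
    [HasColimit (c ⋙ d₁.B)] [HasColimit (c ⋙ bZeroOn d₁.base)]
    [HasColimit ((c ⋙ E.functor.op) ⋙ d₂.B)] [HasColimit ((c ⋙ E.functor.op) ⋙ bZeroOn d₂.base)] :
    Nonempty (colimit (c ⋙ bZeroOn d₁.base) ≅ colimit ((c ⋙ E.functor.op) ⋙ bZeroOn d₂.base)) := by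
  obtain ⟨e₁⟩ := d₁.nonempty_colimit_iso_of_isFieldwiseSaturated hfs₁ c
  obtain ⟨e₂⟩ := d₂.nonempty_colimit_iso_of_isFieldwiseSaturated hfs₂ (c ⋙ E.functor.op)
  obtain ⟨e⟩ := nonempty_colimit_iso_of_equivalence d₁ d₂ E ΨB c
  exact ⟨e₁.symm ≪≫ e ≪≫ e₂⟩

end PadicFrd

end Literature.AlgebraicGeometry.Frobenioids
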